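import Literature.MathematicalPhysics.QuantumFieldTheory.Balaban1983to89.B6Eq295

/-!
# `Balaban1983to89.B6Eq2106` — T. Bałaban, *Propagators and renormalization transformations for lattice gauge theories.
# II*, Commun. Math. Phys. **96** (1984) 223–250 [Balaban1984PropagatorsII], Sect. C p. 242: the remark
# «∫dω′↾_Λ δ(Q′₁ω′)δ(Q′_jλ′ − ω′) = δ(Q′λ′)» and the three equalities of (2.106), PROVED at the level of the iterated
# δ-function integrals (left-invariant measures on the gauge spaces, as in the sibling `…B6Eq295`)

statement-level skeleton of published theorems with citation tags; proofs where landed; nothing here is a claim about the Yang–Mills mass gap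

PDF held: `paper:balaban1984-cmp96-propagators-rt-ii` (journal page = PDF page + 222); p. 242 [PDF 20] read AS AN IMAGE on
the ×2 render `run/shared/lean/pub/pub-balaban/b2b-balaban-ref1/pages/1984-cmp96-propagators-rt-II/…-p020-x2.png`.

CITATION HEADER (lean-in-tree rule).  WHAT IS REPRODUCED: lit-balaban SKELETON row **B6.Eq2.105** ((2.105)–(2.107) p. 242;
until now `typed`: the momentum multiplier `Δ′_j` of (2.107)/(2.108) has a body in `…B6Hprime2101`, the POINTWISE exponent
bookkeeping of the second and third equality of (2.106) is `…B6Eq295.exponent_split_2106` (gen 1) / `eq2106_regroup`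
(gen 3); the δ-function composition remark and the equalities of (2.106) AS IDENTITIES OF THE ITERATED INTEGRALS were only
located).  Unit `lit-balaban-r03` (B6 reader/typer and fold owner, gen 4), PHASE 2 (G.1/G.2(b): typed-not-proved row of the
seat's own block), HOME `run/shared/lean/pub/lit-balaban/`, 2026-08-21.  IMPORTS the sibling `…B6Eq295` (for `B6SectA.hOp`
= the `GQ*E` pattern typing `H′_j = Δ⁻²Q′_j*(Q′_jΔ⁻²Q′_j*)⁻¹` (2.101), and `eq2106_regroup`); nothing of the tree is restated.

PRINT (p. 242 [PDF 20], verbatim).  After (2.105) (*"… · ∫dω↾_Λδ(Q′₁ω)Z′_j⁻¹∫dλ′δ(Q′_jλ′ − ω) e^{−½‖∂*A−Δλ′‖²}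
e^{−⟨∂H′_jω,J⟩} · (Z′⁻¹∫dλδ(Q′λ)e^{−½‖∂*A−Δλ‖²})⁻¹. (2.105)"*): *"Let us notice that ∫dω′↾_Λδ(Q′₁ω′)δ(Q′_jλ′ − ω′)
= δ(Q′λ′), and we use this formula in the last integral above. The integrals over ω's and λ's can be written as
∫dω↾_Λδ(Q′₁ω)∫dλ′δ(Q′_jλ′ − ω)e^{−½‖Δλ′‖² + ⟨Δλ′,∂*A⟩} e^{−⟨∂H′_jω,J⟩} · (∫dω′↾_Λδ(Q′₁ω′)∫dλδ(Q′_jλ − ω′)e^{−½‖Δλ‖² +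
⟨Δλ,∂*A⟩})⁻¹
= ∫dω↾_Λδ(Q′₁ω)e^{−½‖ΔH′_jω‖²}e^{⟨ΔH′_jω,∂*A⟩ − ⟨∂H′_jω,J⟩} · ∫dλ′δ(Q′_jλ′)e^{−½‖Δλ′‖² + ⟨Δλ′,∂*A⟩}
  · (∫dω′↾_Λδ(Q′₁ω′)e^{−½‖ΔH′_jω′‖²}e^{⟨ΔH′_jω′,∂*A⟩} ∫dλδ(Q′_jλ)e^{−½‖Δλ‖² + ⟨Δλ,∂*A⟩})⁻¹
= ∫dω↾_Λδ(Q′₁ω)e^{−½⟨ω,Δ′_jω⟩}e^{⟨ω, H′_j*Δ∂*A − H′_j*∂*J⟩} · (∫dω′↾_Λδ(Q′₁ω′)e^{−½⟨ω′,Δ′_jω′⟩}e^{⟨ω′,H′_j*Δ∂*A⟩})⁻¹, (2.106)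
where the second equality was obtained by the translation λ′ → λ′ + H′_jω, and the same translation in λ, and the operator
Δ′_j was defined by the second equality, Δ′_j = H′_j*Δ²H′_j. (2.107)"*.

HOW THE δ-FUNCTION INTEGRALS ARE TYPED (the convention of `…B6Eq295`, extended to the two-level constraint).  `B` = the real
inner-product space of scalar functions on the `ξ`-lattice (the `λ`'s), `W` = the functions on the unit lattice `T₁^{(j)}`
(the values of `Q′_j`), `Qp : B →ₗ W` = `Q′_j`.  `∫dλ′ δ(Q′_jλ′) F` = `∫ n, F (ι n) ∂μ` over an abstract additive group `Nj`
(= N(Q′_j)) with `ι : Nj →ₗ B`, `Q′_j ∘ ι = 0` (`hι`) and ANY measure `μ` (left-invariant where a translation is used).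
`∫dω↾_Λ δ(Q′₁ω) G` = `∫ ω, G (ε ω) ∂ν` over an abstract group `N1` (= the unit-lattice functions on `Λ` with `Q′₁ω = 0` on
`Λ′`) with `ε : N1 →ₗ W` (extension by zero outside `Λ`) and any measure `ν`.  The FIBRE integral `∫dλ′ δ(Q′_jλ′ − ω) F` =
`∫ n, F (ι n + v) ∂μ` for a point `v` of the fibre (`Q′_jv = εω`); `fibre_section_indep` proves it does not depend on the
choice of `v` (translation invariance of `μ`) — choosing `v = H′_j(εω)` (`Q′_jH′_j = I`, `…B6Eq295.comp_hPrime_eq_id`) IS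
*"the translation λ′ → λ′ + H′_jω"* of the text.  With `Q′λ = 0 ⟺ Q′_jλ ∈ ε(N1)` (the two-level constraint: `Q′_jλ = 0`
off `Λ`, `Q′₁Q′_jλ = 0` on `Λ′`), the remark *"∫dω′↾_Λδ(Q′₁ω′)δ(Q′_jλ′ − ω′) = δ(Q′λ′)"* is typed as: (i) `N(Q′) =
ι(Nj) + H′_j(ε(N1))` with UNIQUE decomposition (`mem_gaugeSpace_iff`, `decomp_unique`), and (ii) the iterated integral
`F ↦ ∫ω ∫n F(ι n + H′_j(ε ω)) ∂μ ∂ν` is invariant under translations by `N(Q′)` (`iterated_translation_invariant`) — i.e. it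
is one of the admitted typings of `∫dλ δ(Q′λ) F`; (iii) §4: in the finite-dimensional model (Lebesgue = additive Haar
measures on the subspaces) the iterated measure IS the Haar measure of `N(Q′)` up to a positive constant
(`iterated_eq_smul_addHaar`), the constant being immaterial in the quotients (2.105)/(2.106).

WHAT IS PROVED (0 sorry, 0 new named facts, theorems only).  §1 `Qp_decomp`, `mem_gaugeSpace_iff`, `decomp_unique`;
§2 `fibre_section_indep` (*"the translation λ′ → λ′ + H′_jω"*), `iterated_translation_invariant`; §3 `exp_neg_half_norm_sub_sq`
((2.105) integrand ⇒ (2.106) integrand: `e^{−½‖∂*A−Δλ‖²} = e^{−½‖∂*A‖²}·e^{−½‖Δλ‖²+⟨Δλ,∂*A⟩}`), `exponent_split_of_orth`,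
`orth_of_hPrime` (the cross term `⟨Δλ′, ΔH′_jω⟩ = 0` on `N(Q′_j)`, from `Δ²H′_j = Q′_j*E`), **`eq2106_num` / `eq2106_den`**
(first = second member, numerator and denominator separately, for a generic fibre point map `hP` with the orthogonality),
**`eq2106_regroup_integral`** (second = third member with `Δ′_j = H′_j*Δ²H′_j`), **`eq2106`** (the printed chain of quotients,
the `λ`-integral `Z_λ = ∫dλδ(Q′_jλ)e^{−½‖Δλ‖²+⟨Δλ,∂*A⟩}` cancelling under `Z_λ ≠ 0`; `eq2106_uncancelled` without that
hypothesis), **`eq2105_quotient`** (the same chain starting from the (2.105) integrands `e^{−½‖∂*A−Δλ‖²}`), and the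
instantiation **`eq2106_hPrime`** with `H′_j = B6SectA.hOp (Δ⁻¹∘Δ⁻¹) Q′_j* E` under the hypotheses of
`…B6Eq295.exponent_split_2106` (`Δ` symmetric, `Q′_j*` adjoint to `Q′_j`, `ΔΔ⁻¹ = I`).  §4 (the only `def`s: `decompMap`,
`decompEquiv`, with bodies) the finite-dimensional Haar model: `decompMap_bijective`, `iterated_isAddHaar`,
**`iterated_eq_smul_addHaar`**, `iterated_lintegral` / `iterated_integral` (Tonelli/Fubini).  Axioms: the standard three.
v1.1 (§5, append-only, same seat): **`eq2105_of_2097_fibre` / `eq2105_of_2097`** — (2.97) ⇒ (2.105) by the gauge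
transformation `A → A − ∂H′_jω` inside the `ω`-integral (translation invariance of `dA` and of `dλ δ(Q′λ)`; the invariance of
the first exponential ((2.98), (2.103)–(2.104)) and (2.103) line 1 `Q_j∂λ = ∂₁Q′_jλ` as displayed hypotheses; normalisations
omitted), and `eq2105_order` (the printed order of integration = Fubini under integrability).
NOT HERE: (2.108)–(2.110) (`…B6Hprime2101`), the value of any normalisation, (2.96)–(2.97) themselves (located in `…B6Eq295`).
-/

noncomputable section

open MeasureTheory
open scoped InnerProductSpace

namespace Literature.MathematicalPhysics.QuantumFieldTheory.Balaban1983to89.B6Eq2106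

/-! ## §1  The decomposition `N(Q′) = N(Q′_j) ⊕ H′_j N(Q′₁)↾_Λ` behind «∫dω′↾_Λδ(Q′₁ω′)δ(Q′_jλ′ − ω′) = δ(Q′λ′)» -/

section Decomposition

variable {R : Type*} [CommRing R]
variable {B W Nj N1 : Type*} [AddCommGroup B] [Module R B] [AddCommGroup W] [Module R W]
  [AddCommGroup Nj] [Module R Nj] [AddCommGroup N1] [Module R N1]

/-- The fibre point `ι n + H′_j(εω)` has `Q′_j`-value `εω` (`Q′_jH′_j = I`, `Q′_jι = 0`): every point produced by the
iterated integral satisfies the two-level constraint `Q′λ = 0`. [cite: Balaban1984PropagatorsII, (2.106) p.242] -/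
theorem Qp_decomp (Qp : B →ₗ[R] W) (H : W →ₗ[R] B) (ι : Nj →ₗ[R] B) (ε : N1 →ₗ[R] W)
    (hH : Qp ∘ₗ H = LinearMap.id) (hι : ∀ n, Qp (ι n) = 0) (n : Nj) (ω : N1) :
    Qp (ι n + H (ε ω)) = ε ω := by
  have h1 : Qp (H (ε ω)) = ε ω := by simpa using LinearMap.congr_fun hH (ε ω)
  rw [map_add, hι, zero_add, h1]

/-- **«∫dω′↾_Λδ(Q′₁ω′)δ(Q′_jλ′ − ω′) = δ(Q′λ′)», set-theoretic content**: `λ` satisfies the two-level constraint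
`Q′λ = 0` (⟺ `Q′_jλ ∈ ε(N1)`: `Q′_jλ = 0` off `Λ` and `Q′₁Q′_jλ = 0` on `Λ′`) iff `λ = λ′ + H′_jω′` with `Q′_jλ′ = 0` and
`ω′` in the domain of `∫dω′↾_Λδ(Q′₁ω′)` — given that `ι` parametrises ALL of `N(Q′_j)` (`hker`).
[cite: Balaban1984PropagatorsII, (2.106) p.242] -/
theorem mem_gaugeSpace_iff (Qp : B →ₗ[R] W) (H : W →ₗ[R] B) (ι : Nj →ₗ[R] B) (ε : N1 →ₗ[R] W)
    (hH : Qp ∘ₗ H = LinearMap.id) (hι : ∀ n, Qp (ι n) = 0) (hker : ∀ l, Qp l = 0 → ∃ n, l = ι n) (l : B) :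
    (∃ ω, Qp l = ε ω) ↔ ∃ n ω, l = ι n + H (ε ω) := by
  constructor
  · rintro ⟨ω, hω⟩
    have h1 : Qp (H (ε ω)) = ε ω := by simpa using LinearMap.congr_fun hH (ε ω)
    obtain ⟨n, hn⟩ := hker (l - H (ε ω)) (by rw [map_sub, hω, h1, sub_self])
    exact ⟨n, ω, by rw [← hn]; abel⟩
  · rintro ⟨n, ω, rfl⟩
    exact ⟨ω, Qp_decomp Qp H ι ε hH hι n ω⟩

/-- **Uniqueness of the decomposition** (the composition of the two δ-functions is again ONE δ-function, not a
multiple cover): with `ι`, `ε` injective, `ι n + H′_j(εω) = ι n′ + H′_j(εω′)` forces `n = n′`, `ω = ω′`.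
[cite: Balaban1984PropagatorsII, (2.106) p.242] -/
theorem decomp_unique (Qp : B →ₗ[R] W) (H : W →ₗ[R] B) (ι : Nj →ₗ[R] B) (ε : N1 →ₗ[R] W)
    (hH : Qp ∘ₗ H = LinearMap.id) (hι : ∀ n, Qp (ι n) = 0) (hιi : Function.Injective ι)
    (hεi : Function.Injective ε) {n n' : Nj} {ω ω' : N1} (h : ι n + H (ε ω) = ι n' + H (ε ω')) :
    n = n' ∧ ω = ω' := by
  have hω : ε ω = ε ω' := by
    have := congrArg Qp h
    rwa [Qp_decomp Qp H ι ε hH hι, Qp_decomp Qp H ι ε hH hι] at this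
  have hω' : ω = ω' := hεi hω
  subst hω'
  have hn : ι n = ι n' := add_right_cancel h
  exact ⟨hιi hn, rfl⟩

/-- The two statements combined: every `λ` with `Q′λ = 0` is `ι n + H′_j(εω)` for EXACTLY ONE pair `(n, ω)`.
[cite: Balaban1984PropagatorsII, (2.106) p.242] -/
theorem existsUnique_decomp (Qp : B →ₗ[R] W) (H : W →ₗ[R] B) (ι : Nj →ₗ[R] B) (ε : N1 →ₗ[R] W)
    (hH : Qp ∘ₗ H = LinearMap.id) (hι : ∀ n, Qp (ι n) = 0) (hker : ∀ l, Qp l = 0 → ∃ n, l = ι n)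
    (hιi : Function.Injective ι) (hεi : Function.Injective ε) (l : B) (hl : ∃ ω, Qp l = ε ω) :
    ∃! p : Nj × N1, l = ι p.1 + H (ε p.2) := by
  obtain ⟨n, ω, rfl⟩ := (mem_gaugeSpace_iff Qp H ι ε hH hι hker l).1 hl
  refine ⟨(n, ω), rfl, ?_⟩
  rintro ⟨n', ω'⟩ h'
  obtain ⟨h1, h2⟩ := decomp_unique Qp H ι ε hH hι hιi hεi h'.symm
  exact Prod.ext h1 h2

end Decomposition

/-! ## §2  Fibre integrals: «the translation λ′ → λ′ + H′_jω» and the invariance of the iterated integral -/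

section Fibre

variable {B W Nj N1 : Type*} [AddCommGroup B] [Module ℝ B] [AddCommGroup W] [Module ℝ W]
  [AddCommGroup Nj] [Module ℝ Nj] [MeasurableSpace Nj] [AddCommGroup N1] [Module ℝ N1] [MeasurableSpace N1]

/-- **«the translation λ′ → λ′ + H′_jω»**: the fibre integral `∫dλ′ δ(Q′_jλ′ − ω) F(λ′)`, typed as `∫ n, F (ι n + v) ∂μ`
for a point `v` of the fibre, does not depend on the point chosen: if `Q′_jv = Q′_jv′` then `v − v′ ∈ N(Q′_j)` and the
translation invariance of `μ` moves one parametrisation to the other (in the text: from any `λ′` with `Q′_jλ′ = ω` to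
`λ′ + H′_jω` with `Q′_jλ′ = 0`). [cite: Balaban1984PropagatorsII, (2.106) p.242] -/
theorem fibre_section_indep [MeasurableAdd Nj] (μ : Measure Nj) [μ.IsAddLeftInvariant]
    (Qp : B →ₗ[ℝ] W) (ι : Nj →ₗ[ℝ] B) (hker : ∀ l, Qp l = 0 → ∃ n, l = ι n)
    (F : B → ℝ) (v v' : B) (hv : Qp v = Qp v') :
    ∫ n, F (ι n + v) ∂μ = ∫ n, F (ι n + v') ∂μ := by
  obtain ⟨n₀, hn₀⟩ := hker (v - v') (by rw [map_sub, hv, sub_self])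
  have hv' : v = ι n₀ + v' := by rw [← hn₀]; abel
  have hfun : (fun n => F (ι n + v)) = fun n => (fun m => F (ι m + v')) (n₀ + n) := by
    funext n
    simp only [hv', map_add]
    congr 1
    abel
  rw [hfun]
  exact integral_add_left_eq_self (fun m => F (ι m + v')) n₀

/-- **The iterated integral is an admitted typing of `∫dλ δ(Q′λ)`**: the functional
`F ↦ ∫dω↾_Λδ(Q′₁ω) ∫dλ′δ(Q′_jλ′ − ω) F(λ′)` = `∫ ω, ∫ n, F (ι n + H′_j(ε ω)) ∂μ ∂ν` is invariant under the translations
of `B` by the elements `ι n₀ + H′_j(εω₀)` of `N(Q′)` (all of them, by `mem_gaugeSpace_iff`), for left-invariant `μ`, `ν` —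
no integrability hypothesis. [cite: Balaban1984PropagatorsII, (2.106) p.242] -/
theorem iterated_translation_invariant [MeasurableAdd Nj] [MeasurableAdd N1] (μ : Measure Nj) [μ.IsAddLeftInvariant]
    (ν : Measure N1) [ν.IsAddLeftInvariant] (H : W →ₗ[ℝ] B) (ι : Nj →ₗ[ℝ] B) (ε : N1 →ₗ[ℝ] W)
    (F : B → ℝ) (n₀ : Nj) (ω₀ : N1) :
    ∫ ω, ∫ n, F (ι n + H (ε ω) + (ι n₀ + H (ε ω₀))) ∂μ ∂ν = ∫ ω, ∫ n, F (ι n + H (ε ω)) ∂μ ∂ν := by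
  have hpt : ∀ ω n, F (ι n + H (ε ω) + (ι n₀ + H (ε ω₀))) =
      (fun m => F (ι m + H (ε (ω₀ + ω)))) (n₀ + n) := by
    intro ω n
    simp only [map_add]
    congr 1
    abel
  have hinner : ∀ ω, ∫ n, F (ι n + H (ε ω) + (ι n₀ + H (ε ω₀))) ∂μ = ∫ n, F (ι n + H (ε (ω₀ + ω))) ∂μ := by
    intro ω
    simp_rw [hpt ω]
    exact integral_add_left_eq_self (fun m => F (ι m + H (ε (ω₀ + ω)))) n₀
  simp_rw [hinner]
  exact integral_add_left_eq_self (fun ω => ∫ n, F (ι n + H (ε ω)) ∂μ) ω₀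

/-- The use made of the remark in (2.105) (*"we use this formula in the last integral above"*): the last factor
`∫dλ δ(Q′λ) e^{−½‖∂*A−Δλ‖²}` of (2.105) becomes the iterated integral `∫dω′↾_Λδ(Q′₁ω′)∫dλδ(Q′_jλ − ω′)e^{−½‖∂*A−Δλ‖²}`
of the first member of (2.106) — in the typing, for ANY parametrisation `s` of the fibres (`Q′_j(s ω′) = εω′`) the
iterated integral equals the one through `H′_j` (section independence fibrewise). [cite: Balaban1984PropagatorsII, (2.105)–(2.106) p.242] -/
theorem iterated_section_indep [MeasurableAdd Nj] (μ : Measure Nj) [μ.IsAddLeftInvariant] (ν : Measure N1)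
    (Qp : B →ₗ[ℝ] W) (H : W →ₗ[ℝ] B) (ι : Nj →ₗ[ℝ] B) (ε : N1 →ₗ[ℝ] W)
    (hH : Qp ∘ₗ H = LinearMap.id) (hker : ∀ l, Qp l = 0 → ∃ n, l = ι n)
    (s : N1 → B) (hs : ∀ ω, Qp (s ω) = ε ω) (F : B → ℝ) :
    ∫ ω, ∫ n, F (ι n + s ω) ∂μ ∂ν = ∫ ω, ∫ n, F (ι n + H (ε ω)) ∂μ ∂ν := by
  congr 1
  funext ω
  refine fibre_section_indep μ Qp ι hker F (s ω) (H (ε ω)) ?_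
  have h1 : Qp (H (ε ω)) = ε ω := by simpa using LinearMap.congr_fun hH (ε ω)
  rw [hs, h1]

end Fibre

/-! ## §3  The three equalities of (2.106) as identities of iterated integrals -/

section Eq2106

variable {B W A Nj N1 : Type*} [NormedAddCommGroup B] [InnerProductSpace ℝ B] [NormedAddCommGroup W]
  [InnerProductSpace ℝ W] [NormedAddCommGroup A] [InnerProductSpace ℝ A]
  [AddCommGroup Nj] [Module ℝ Nj] [MeasurableSpace Nj] [AddCommGroup N1] [Module ℝ N1] [MeasurableSpace N1]

/-- (2.105) integrand ⇒ (2.106) integrand: `e^{−½‖∂*A − Δλ‖²} = e^{−½‖∂*A‖²} · e^{−½‖Δλ‖² + ⟨Δλ, ∂*A⟩}` (the factor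
`e^{−½‖∂*A‖²}` is common to numerator and denominator of (2.105) and is dropped in (2.106)). [cite: Balaban1984PropagatorsII, (2.105)–(2.106) p.242] -/
theorem exp_neg_half_norm_sub_sq (g x : B) :
    Real.exp (-(1 / 2) * ‖g - x‖ ^ 2) =
      Real.exp (-(1 / 2) * ‖g‖ ^ 2) * Real.exp (-(1 / 2) * ‖x‖ ^ 2 + ⟪x, g⟫_ℝ) := by
  rw [← Real.exp_add]
  congr 1
  rw [norm_sub_sq_real, real_inner_comm]
  ring

/-- Pointwise exponent split on a fibre: if the cross term `⟨Δa, Δb⟩` vanishes then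
`−½‖Δ(a + b)‖² + ⟨Δ(a + b), g⟩ = (−½‖Δb‖² + ⟨Δb, g⟩) + (−½‖Δa‖² + ⟨Δa, g⟩)`. [cite: Balaban1984PropagatorsII, (2.106) p.242] -/
theorem exponent_split_of_orth (lap : B →ₗ[ℝ] B) (a b g : B) (h : ⟪lap a, lap b⟫_ℝ = 0) :
    -(1 / 2) * ‖lap (a + b)‖ ^ 2 + ⟪lap (a + b), g⟫_ℝ =
      (-(1 / 2) * ‖lap b‖ ^ 2 + ⟪lap b, g⟫_ℝ) + (-(1 / 2) * ‖lap a‖ ^ 2 + ⟪lap a, g⟫_ℝ) := by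
  rw [map_add, norm_add_sq_real, h, inner_add_left]
  ring

/-- The orthogonality for the printed `H′_j = Δ⁻²Q′_j*(Q′_jΔ⁻²Q′_j*)⁻¹` (2.101): for `Δ` symmetric with `ΔΔ⁻¹ = I` and
`Q′_j*` the adjoint of `Q′_j`, `⟨Δλ′, ΔH′_jw⟩ = ⟨Q′_jλ′, Ew⟩ = 0` whenever `Q′_jλ′ = 0` (since `Δ²H′_jw = Q′_j*Ew`).
[cite: Balaban1984PropagatorsII, (2.101)–(2.106) pp.241–242] -/
theorem orth_of_hPrime (lap Dinv : B →ₗ[ℝ] B) (Qp : B →ₗ[ℝ] W) (Qps : W →ₗ[ℝ] B) (E : W →ₗ[ℝ] W)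
    (hlap : ∀ x y : B, ⟪lap x, y⟫_ℝ = ⟪x, lap y⟫_ℝ) (hadj : ∀ (w : W) (v : B), ⟪Qps w, v⟫_ℝ = ⟪w, Qp v⟫_ℝ)
    (hinv : lap ∘ₗ Dinv = LinearMap.id) (l' : B) (hl' : Qp l' = 0) (w : W) :
    ⟪lap l', lap (B6SectA.hOp (Dinv ∘ₗ Dinv) Qps E w)⟫_ℝ = 0 := by
  have h1 : ∀ x, lap (Dinv x) = x := fun x => by simpa using LinearMap.congr_fun hinv x
  have h2 : lap (lap (B6SectA.hOp (Dinv ∘ₗ Dinv) Qps E w)) = Qps (E w) := by simp [B6SectA.hOp, h1]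
  rw [hlap, h2, real_inner_comm, hadj, hl', inner_zero_right]

/-- **(2.106), first = second member, NUMERATOR**: for a fibre point map `hP` (= `H′_j`) whose `Δ`-image is orthogonal to
`ΔN(Q′_j)` (`horth`, = `orth_of_hPrime` for the printed `H′_j`),
`∫dω↾δ(Q′₁ω) [e^{−⟨∂H′_jω,J⟩} ∫dλ′δ(Q′_jλ′ − ω) e^{−½‖Δλ′‖² + ⟨Δλ′,∂*A⟩}]
 = ∫dω↾δ(Q′₁ω) e^{−½‖ΔH′_jω‖²} e^{⟨ΔH′_jω,∂*A⟩ − ⟨∂H′_jω,J⟩} · ∫dλ′δ(Q′_jλ′) e^{−½‖Δλ′‖² + ⟨Δλ′,∂*A⟩}`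
(the exponent splits without cross term; the `λ′`-integral no longer depends on `ω` and factors out).  Any measures; no
integrability hypothesis. (`g` = `∂*A`, `grad` = `∂`.) [cite: Balaban1984PropagatorsII, (2.106) p.242] -/
theorem eq2106_num (μ : Measure Nj) (ν : Measure N1) (lap : B →ₗ[ℝ] B) (hP : W →ₗ[ℝ] B) (grad : B →ₗ[ℝ] A)
    (ι : Nj →ₗ[ℝ] B) (ε : N1 →ₗ[ℝ] W) (horth : ∀ (n : Nj) (w : W), ⟪lap (ι n), lap (hP w)⟫_ℝ = 0) (g : B) (J : A) :
    ∫ ω, Real.exp (-⟪grad (hP (ε ω)), J⟫_ℝ) *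
        (∫ n, Real.exp (-(1 / 2) * ‖lap (ι n + hP (ε ω))‖ ^ 2 + ⟪lap (ι n + hP (ε ω)), g⟫_ℝ) ∂μ) ∂ν =
      (∫ ω, Real.exp (-(1 / 2) * ‖lap (hP (ε ω))‖ ^ 2) *
          Real.exp (⟪lap (hP (ε ω)), g⟫_ℝ - ⟪grad (hP (ε ω)), J⟫_ℝ) ∂ν) *
        ∫ n, Real.exp (-(1 / 2) * ‖lap (ι n)‖ ^ 2 + ⟪lap (ι n), g⟫_ℝ) ∂μ := by
  have hinner : ∀ ω, ∫ n, Real.exp (-(1 / 2) * ‖lap (ι n + hP (ε ω))‖ ^ 2 + ⟪lap (ι n + hP (ε ω)), g⟫_ℝ) ∂μ =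
      Real.exp (-(1 / 2) * ‖lap (hP (ε ω))‖ ^ 2 + ⟪lap (hP (ε ω)), g⟫_ℝ) *
        ∫ n, Real.exp (-(1 / 2) * ‖lap (ι n)‖ ^ 2 + ⟪lap (ι n), g⟫_ℝ) ∂μ := by
    intro ω
    rw [← integral_const_mul]
    congr 1
    funext n
    rw [exponent_split_of_orth lap (ι n) (hP (ε ω)) g (horth n (ε ω)), Real.exp_add]
  simp_rw [hinner, ← mul_assoc]
  rw [integral_mul_const]
  congr 1
  congr 1
  funext ω
  rw [← Real.exp_add, ← Real.exp_add]
  congr 1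
  ring

/-- **(2.106), first = second member, DENOMINATOR**: the same factorisation without the `J`-factor:
`∫dω′↾δ(Q′₁ω′)∫dλδ(Q′_jλ − ω′)e^{−½‖Δλ‖² + ⟨Δλ,∂*A⟩}
 = ∫dω′↾δ(Q′₁ω′)e^{−½‖ΔH′_jω′‖²}e^{⟨ΔH′_jω′,∂*A⟩} · ∫dλδ(Q′_jλ)e^{−½‖Δλ‖² + ⟨Δλ,∂*A⟩}`.
[cite: Balaban1984PropagatorsII, (2.106) p.242] -/
theorem eq2106_den (μ : Measure Nj) (ν : Measure N1) (lap : B →ₗ[ℝ] B) (hP : W →ₗ[ℝ] B)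
    (ι : Nj →ₗ[ℝ] B) (ε : N1 →ₗ[ℝ] W) (horth : ∀ (n : Nj) (w : W), ⟪lap (ι n), lap (hP w)⟫_ℝ = 0) (g : B) :
    ∫ ω, (∫ n, Real.exp (-(1 / 2) * ‖lap (ι n + hP (ε ω))‖ ^ 2 + ⟪lap (ι n + hP (ε ω)), g⟫_ℝ) ∂μ) ∂ν =
      (∫ ω, Real.exp (-(1 / 2) * ‖lap (hP (ε ω))‖ ^ 2) * Real.exp (⟪lap (hP (ε ω)), g⟫_ℝ) ∂ν) *
        ∫ n, Real.exp (-(1 / 2) * ‖lap (ι n)‖ ^ 2 + ⟪lap (ι n), g⟫_ℝ) ∂μ := by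
  have hinner : ∀ ω, ∫ n, Real.exp (-(1 / 2) * ‖lap (ι n + hP (ε ω))‖ ^ 2 + ⟪lap (ι n + hP (ε ω)), g⟫_ℝ) ∂μ =
      Real.exp (-(1 / 2) * ‖lap (hP (ε ω))‖ ^ 2 + ⟪lap (hP (ε ω)), g⟫_ℝ) *
        ∫ n, Real.exp (-(1 / 2) * ‖lap (ι n)‖ ^ 2 + ⟪lap (ι n), g⟫_ℝ) ∂μ := by
    intro ω
    rw [← integral_const_mul]
    congr 1
    funext n
    rw [exponent_split_of_orth lap (ι n) (hP (ε ω)) g (horth n (ε ω)), Real.exp_add]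
  simp_rw [hinner]
  rw [integral_mul_const]
  congr 1
  congr 1
  funext ω
  rw [← Real.exp_add]

/-- **(2.106), second = third member** (with (2.107) `Δ′_j = H′_j*Δ²H′_j`): the `ω`-integrands regroup by adjointness
(`H′_j*` = `hPs` adjoint to `hP`, `∂*` = `dv` adjoint to `grad`, `Δ` symmetric) —
`∫dω↾δ(Q′₁ω)e^{−½‖ΔH′_jω‖²}e^{⟨ΔH′_jω,∂*A⟩ − ⟨∂H′_jω,J⟩} = ∫dω↾δ(Q′₁ω)e^{−½⟨ω,Δ′_jω⟩}e^{⟨ω, H′_j*Δ∂*A − H′_j*∂*J⟩}`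
(pointwise `…B6Eq295.eq2106_regroup`). [cite: Balaban1984PropagatorsII, (2.106)–(2.107) p.242] -/
theorem eq2106_regroup_integral (ν : Measure N1) (lap : B →ₗ[ℝ] B) (hP : W →ₗ[ℝ] B) (hPs : B →ₗ[ℝ] W)
    (grad : B →ₗ[ℝ] A) (dv : A →ₗ[ℝ] B) (ε : N1 →ₗ[ℝ] W)
    (hlap : ∀ x y : B, ⟪lap x, y⟫_ℝ = ⟪x, lap y⟫_ℝ) (hH : ∀ (w : W) (b : B), ⟪hP w, b⟫_ℝ = ⟪w, hPs b⟫_ℝ)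
    (hgrad : ∀ (b : B) (J : A), ⟪grad b, J⟫_ℝ = ⟪b, dv J⟫_ℝ) (g : B) (J : A) :
    ∫ ω, Real.exp (-(1 / 2) * ‖lap (hP (ε ω))‖ ^ 2) *
        Real.exp (⟪lap (hP (ε ω)), g⟫_ℝ - ⟪grad (hP (ε ω)), J⟫_ℝ) ∂ν =
      ∫ ω, Real.exp (-(1 / 2) * ⟪ε ω, (hPs ∘ₗ lap ∘ₗ lap ∘ₗ hP) (ε ω)⟫_ℝ) *
        Real.exp (⟪ε ω, hPs (lap g) - hPs (dv J)⟫_ℝ) ∂ν := by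
  congr 1
  funext ω
  rw [← Real.exp_add, ← Real.exp_add]
  congr 1
  have h := B6Eq295.eq2106_regroup lap hP hPs grad dv hlap hH hgrad (ε ω) g J
  linarith

/-- The `J = 0` case of the regrouping (the DENOMINATOR of the third member):
`∫dω′↾δ(Q′₁ω′)e^{−½‖ΔH′_jω′‖²}e^{⟨ΔH′_jω′,∂*A⟩} = ∫dω′↾δ(Q′₁ω′)e^{−½⟨ω′,Δ′_jω′⟩}e^{⟨ω′,H′_j*Δ∂*A⟩}`.
[cite: Balaban1984PropagatorsII, (2.106)–(2.107) p.242] -/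
theorem eq2106_regroup_integral_den (ν : Measure N1) (lap : B →ₗ[ℝ] B) (hP : W →ₗ[ℝ] B) (hPs : B →ₗ[ℝ] W)
    (ε : N1 →ₗ[ℝ] W) (hlap : ∀ x y : B, ⟪lap x, y⟫_ℝ = ⟪x, lap y⟫_ℝ)
    (hH : ∀ (w : W) (b : B), ⟪hP w, b⟫_ℝ = ⟪w, hPs b⟫_ℝ) (g : B) :
    ∫ ω, Real.exp (-(1 / 2) * ‖lap (hP (ε ω))‖ ^ 2) * Real.exp (⟪lap (hP (ε ω)), g⟫_ℝ) ∂ν =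
      ∫ ω, Real.exp (-(1 / 2) * ⟪ε ω, (hPs ∘ₗ lap ∘ₗ lap ∘ₗ hP) (ε ω)⟫_ℝ) *
        Real.exp (⟪ε ω, hPs (lap g)⟫_ℝ) ∂ν := by
  congr 1
  funext ω
  rw [← Real.exp_add, ← Real.exp_add]
  congr 1
  have h1 := (B6Eq295.inner_deltaPrimeJ_eq_norm_sq lap hP hPs hlap hH (ε ω)).1
  have h2 : ⟪lap (hP (ε ω)), g⟫_ℝ = ⟪ε ω, hPs (lap g)⟫_ℝ := by rw [hlap, hH]
  rw [h1, h2]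

/-- **(2.106), the printed chain of quotients, uncancelled**: first member = second member, and the second member's
`ω`-integrals regrouped into the third member's, the common `λ`-integral `Z_λ = ∫dλδ(Q′_jλ)e^{−½‖Δλ‖²+⟨Δλ,∂*A⟩}` still
displayed (`x⁻¹` is Lean's total inverse). [cite: Balaban1984PropagatorsII, (2.106)–(2.107) p.242] -/
theorem eq2106_uncancelled (μ : Measure Nj) (ν : Measure N1) (lap : B →ₗ[ℝ] B) (hP : W →ₗ[ℝ] B)
    (hPs : B →ₗ[ℝ] W) (grad : B →ₗ[ℝ] A) (dv : A →ₗ[ℝ] B) (ι : Nj →ₗ[ℝ] B) (ε : N1 →ₗ[ℝ] W)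
    (horth : ∀ (n : Nj) (w : W), ⟪lap (ι n), lap (hP w)⟫_ℝ = 0)
    (hlap : ∀ x y : B, ⟪lap x, y⟫_ℝ = ⟪x, lap y⟫_ℝ) (hH : ∀ (w : W) (b : B), ⟪hP w, b⟫_ℝ = ⟪w, hPs b⟫_ℝ)
    (hgrad : ∀ (b : B) (J : A), ⟪grad b, J⟫_ℝ = ⟪b, dv J⟫_ℝ) (g : B) (J : A) :
    (∫ ω, Real.exp (-⟪grad (hP (ε ω)), J⟫_ℝ) *
        (∫ n, Real.exp (-(1 / 2) * ‖lap (ι n + hP (ε ω))‖ ^ 2 + ⟪lap (ι n + hP (ε ω)), g⟫_ℝ) ∂μ) ∂ν) *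
      (∫ ω, (∫ n, Real.exp (-(1 / 2) * ‖lap (ι n + hP (ε ω))‖ ^ 2 + ⟪lap (ι n + hP (ε ω)), g⟫_ℝ) ∂μ) ∂ν)⁻¹ =
    ((∫ ω, Real.exp (-(1 / 2) * ⟪ε ω, (hPs ∘ₗ lap ∘ₗ lap ∘ₗ hP) (ε ω)⟫_ℝ) *
          Real.exp (⟪ε ω, hPs (lap g) - hPs (dv J)⟫_ℝ) ∂ν) *
        ∫ n, Real.exp (-(1 / 2) * ‖lap (ι n)‖ ^ 2 + ⟪lap (ι n), g⟫_ℝ) ∂μ) *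
      ((∫ ω, Real.exp (-(1 / 2) * ⟪ε ω, (hPs ∘ₗ lap ∘ₗ lap ∘ₗ hP) (ε ω)⟫_ℝ) *
            Real.exp (⟪ε ω, hPs (lap g)⟫_ℝ) ∂ν) *
          ∫ n, Real.exp (-(1 / 2) * ‖lap (ι n)‖ ^ 2 + ⟪lap (ι n), g⟫_ℝ) ∂μ)⁻¹ := by
  rw [eq2106_num μ ν lap hP grad ι ε horth g J, eq2106_den μ ν lap hP ι ε horth g,
    eq2106_regroup_integral ν lap hP hPs grad dv ε hlap hH hgrad g J,
    eq2106_regroup_integral_den ν lap hP hPs ε hlap hH g]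

/-- **(2.106) as printed (first member = third member)**, the `λ`-integrals `∫dλ′δ(Q′_jλ′)e^{…}` and `∫dλδ(Q′_jλ)e^{…}`
of the second member cancelling in the quotient — under the hypothesis that this common Gaussian normalisation `Z_λ` is
not zero (it is a positive Gaussian integral in the text; in the typing `∫` of a non-integrable function is `0`).
[cite: Balaban1984PropagatorsII, (2.106)–(2.107) p.242] -/
theorem eq2106 (μ : Measure Nj) (ν : Measure N1) (lap : B →ₗ[ℝ] B) (hP : W →ₗ[ℝ] B)
    (hPs : B →ₗ[ℝ] W) (grad : B →ₗ[ℝ] A) (dv : A →ₗ[ℝ] B) (ι : Nj →ₗ[ℝ] B) (ε : N1 →ₗ[ℝ] W)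
    (horth : ∀ (n : Nj) (w : W), ⟪lap (ι n), lap (hP w)⟫_ℝ = 0)
    (hlap : ∀ x y : B, ⟪lap x, y⟫_ℝ = ⟪x, lap y⟫_ℝ) (hH : ∀ (w : W) (b : B), ⟪hP w, b⟫_ℝ = ⟪w, hPs b⟫_ℝ)
    (hgrad : ∀ (b : B) (J : A), ⟪grad b, J⟫_ℝ = ⟪b, dv J⟫_ℝ) (g : B) (J : A)
    (hZ : ∫ n, Real.exp (-(1 / 2) * ‖lap (ι n)‖ ^ 2 + ⟪lap (ι n), g⟫_ℝ) ∂μ ≠ 0) :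
    (∫ ω, Real.exp (-⟪grad (hP (ε ω)), J⟫_ℝ) *
        (∫ n, Real.exp (-(1 / 2) * ‖lap (ι n + hP (ε ω))‖ ^ 2 + ⟪lap (ι n + hP (ε ω)), g⟫_ℝ) ∂μ) ∂ν) *
      (∫ ω, (∫ n, Real.exp (-(1 / 2) * ‖lap (ι n + hP (ε ω))‖ ^ 2 + ⟪lap (ι n + hP (ε ω)), g⟫_ℝ) ∂μ) ∂ν)⁻¹ =
    (∫ ω, Real.exp (-(1 / 2) * ⟪ε ω, (hPs ∘ₗ lap ∘ₗ lap ∘ₗ hP) (ε ω)⟫_ℝ) *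
          Real.exp (⟪ε ω, hPs (lap g) - hPs (dv J)⟫_ℝ) ∂ν) *
      (∫ ω, Real.exp (-(1 / 2) * ⟪ε ω, (hPs ∘ₗ lap ∘ₗ lap ∘ₗ hP) (ε ω)⟫_ℝ) *
          Real.exp (⟪ε ω, hPs (lap g)⟫_ℝ) ∂ν)⁻¹ := by
  rw [eq2106_uncancelled μ ν lap hP hPs grad dv ι ε horth hlap hH hgrad g J, mul_inv, mul_mul_mul_comm,
    mul_inv_cancel₀ hZ, mul_one]

/-- **(2.105) ⇒ (2.106), the whole chain from the (2.105) integrands**: with the integrands `e^{−½‖∂*A − Δλ‖²}` of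
(2.105) (and the two-level constraint of its last factor already written as the iterated integral, `iterated_section_indep`),
the quotient equals the third member of (2.106): the factor `e^{−½‖∂*A‖²}` cancels first (`exp_neg_half_norm_sub_sq`),
then `eq2106`. [cite: Balaban1984PropagatorsII, (2.105)–(2.107) p.242] -/
theorem eq2105_quotient (μ : Measure Nj) (ν : Measure N1) (lap : B →ₗ[ℝ] B) (hP : W →ₗ[ℝ] B)
    (hPs : B →ₗ[ℝ] W) (grad : B →ₗ[ℝ] A) (dv : A →ₗ[ℝ] B) (ι : Nj →ₗ[ℝ] B) (ε : N1 →ₗ[ℝ] W)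
    (horth : ∀ (n : Nj) (w : W), ⟪lap (ι n), lap (hP w)⟫_ℝ = 0)
    (hlap : ∀ x y : B, ⟪lap x, y⟫_ℝ = ⟪x, lap y⟫_ℝ) (hH : ∀ (w : W) (b : B), ⟪hP w, b⟫_ℝ = ⟪w, hPs b⟫_ℝ)
    (hgrad : ∀ (b : B) (J : A), ⟪grad b, J⟫_ℝ = ⟪b, dv J⟫_ℝ) (g : B) (J : A)
    (hZ : ∫ n, Real.exp (-(1 / 2) * ‖lap (ι n)‖ ^ 2 + ⟪lap (ι n), g⟫_ℝ) ∂μ ≠ 0) :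
    (∫ ω, Real.exp (-⟪grad (hP (ε ω)), J⟫_ℝ) *
        (∫ n, Real.exp (-(1 / 2) * ‖g - lap (ι n + hP (ε ω))‖ ^ 2) ∂μ) ∂ν) *
      (∫ ω, (∫ n, Real.exp (-(1 / 2) * ‖g - lap (ι n + hP (ε ω))‖ ^ 2) ∂μ) ∂ν)⁻¹ =
    (∫ ω, Real.exp (-(1 / 2) * ⟪ε ω, (hPs ∘ₗ lap ∘ₗ lap ∘ₗ hP) (ε ω)⟫_ℝ) *
          Real.exp (⟪ε ω, hPs (lap g) - hPs (dv J)⟫_ℝ) ∂ν) *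
      (∫ ω, Real.exp (-(1 / 2) * ⟪ε ω, (hPs ∘ₗ lap ∘ₗ lap ∘ₗ hP) (ε ω)⟫_ℝ) *
          Real.exp (⟪ε ω, hPs (lap g)⟫_ℝ) ∂ν)⁻¹ := by
  have hexp : ∀ x : B, Real.exp (-(1 / 2) * ‖g - x‖ ^ 2) =
      Real.exp (-(1 / 2) * ‖g‖ ^ 2) * Real.exp (-(1 / 2) * ‖x‖ ^ 2 + ⟪x, g⟫_ℝ) :=
    fun x => exp_neg_half_norm_sub_sq g x
  have hin : ∀ ω, ∫ n, Real.exp (-(1 / 2) * ‖g - lap (ι n + hP (ε ω))‖ ^ 2) ∂μ =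
      Real.exp (-(1 / 2) * ‖g‖ ^ 2) *
        ∫ n, Real.exp (-(1 / 2) * ‖lap (ι n + hP (ε ω))‖ ^ 2 + ⟪lap (ι n + hP (ε ω)), g⟫_ℝ) ∂μ := by
    intro ω
    rw [← integral_const_mul]
    congr 1
    funext n
    exact hexp _
  have hc : Real.exp (-(1 / 2) * ‖g‖ ^ 2) ≠ 0 := Real.exp_ne_zero _
  simp_rw [hin]
  have hnum : ∫ ω, Real.exp (-⟪grad (hP (ε ω)), J⟫_ℝ) * (Real.exp (-(1 / 2) * ‖g‖ ^ 2) *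
        ∫ n, Real.exp (-(1 / 2) * ‖lap (ι n + hP (ε ω))‖ ^ 2 + ⟪lap (ι n + hP (ε ω)), g⟫_ℝ) ∂μ) ∂ν =
      Real.exp (-(1 / 2) * ‖g‖ ^ 2) * ∫ ω, Real.exp (-⟪grad (hP (ε ω)), J⟫_ℝ) *
        (∫ n, Real.exp (-(1 / 2) * ‖lap (ι n + hP (ε ω))‖ ^ 2 + ⟪lap (ι n + hP (ε ω)), g⟫_ℝ) ∂μ) ∂ν := by
    rw [← integral_const_mul]
    congr 1
    funext ω
    ring
  rw [hnum, integral_const_mul, mul_inv, mul_mul_mul_comm, mul_inv_cancel₀ hc, one_mul]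
  exact eq2106 μ ν lap hP hPs grad dv ι ε horth hlap hH hgrad g J hZ

/-- **(2.106) for the printed `H′_j`** = `B6SectA.hOp (Δ⁻¹∘Δ⁻¹) Q′_j* E` of (2.101) (`E` = `(Q′_jΔ⁻²Q′_j*)⁻¹`): under the
hypotheses of `…B6Eq295.exponent_split_2106` (`Δ` symmetric, `Q′_j*` adjoint to `Q′_j`, `ΔΔ⁻¹ = I`) and `Q′_jι = 0` the
orthogonality `horth` of `eq2106` HOLDS (`orth_of_hPrime`), so the printed chain (2.106) holds for every adjoint `H′_j*`
of `H′_j` and `∂*` of `∂`. [cite: Balaban1984PropagatorsII, (2.106)–(2.107) p.242] -/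
theorem eq2106_hPrime (μ : Measure Nj) (ν : Measure N1) (lap Dinv : B →ₗ[ℝ] B) (Qp : B →ₗ[ℝ] W)
    (Qps : W →ₗ[ℝ] B) (E : W →ₗ[ℝ] W) (hPs : B →ₗ[ℝ] W) (grad : B →ₗ[ℝ] A) (dv : A →ₗ[ℝ] B)
    (ι : Nj →ₗ[ℝ] B) (ε : N1 →ₗ[ℝ] W)
    (hlap : ∀ x y : B, ⟪lap x, y⟫_ℝ = ⟪x, lap y⟫_ℝ) (hadj : ∀ (w : W) (v : B), ⟪Qps w, v⟫_ℝ = ⟪w, Qp v⟫_ℝ)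
    (hinv : lap ∘ₗ Dinv = LinearMap.id) (hι : ∀ n, Qp (ι n) = 0)
    (hH : ∀ (w : W) (b : B), ⟪B6SectA.hOp (Dinv ∘ₗ Dinv) Qps E w, b⟫_ℝ = ⟪w, hPs b⟫_ℝ)
    (hgrad : ∀ (b : B) (J : A), ⟪grad b, J⟫_ℝ = ⟪b, dv J⟫_ℝ) (g : B) (J : A)
    (hZ : ∫ n, Real.exp (-(1 / 2) * ‖lap (ι n)‖ ^ 2 + ⟪lap (ι n), g⟫_ℝ) ∂μ ≠ 0) :
    (∫ ω, Real.exp (-⟪grad (B6SectA.hOp (Dinv ∘ₗ Dinv) Qps E (ε ω)), J⟫_ℝ) *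
        (∫ n, Real.exp (-(1 / 2) * ‖lap (ι n + B6SectA.hOp (Dinv ∘ₗ Dinv) Qps E (ε ω))‖ ^ 2 +
          ⟪lap (ι n + B6SectA.hOp (Dinv ∘ₗ Dinv) Qps E (ε ω)), g⟫_ℝ) ∂μ) ∂ν) *
      (∫ ω, (∫ n, Real.exp (-(1 / 2) * ‖lap (ι n + B6SectA.hOp (Dinv ∘ₗ Dinv) Qps E (ε ω))‖ ^ 2 +
          ⟪lap (ι n + B6SectA.hOp (Dinv ∘ₗ Dinv) Qps E (ε ω)), g⟫_ℝ) ∂μ) ∂ν)⁻¹ =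
    (∫ ω, Real.exp (-(1 / 2) *
            ⟪ε ω, (hPs ∘ₗ lap ∘ₗ lap ∘ₗ B6SectA.hOp (Dinv ∘ₗ Dinv) Qps E) (ε ω)⟫_ℝ) *
          Real.exp (⟪ε ω, hPs (lap g) - hPs (dv J)⟫_ℝ) ∂ν) *
      (∫ ω, Real.exp (-(1 / 2) *
            ⟪ε ω, (hPs ∘ₗ lap ∘ₗ lap ∘ₗ B6SectA.hOp (Dinv ∘ₗ Dinv) Qps E) (ε ω)⟫_ℝ) *
          Real.exp (⟪ε ω, hPs (lap g)⟫_ℝ) ∂ν)⁻¹ :=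
  eq2106 μ ν lap (B6SectA.hOp (Dinv ∘ₗ Dinv) Qps E) hPs grad dv ι ε
    (fun n w => orth_of_hPrime lap Dinv Qp Qps E hlap hadj hinv (ι n) (hι n) w) hlap hH hgrad g J hZ

end Eq2106

/-! ## §4  The finite-dimensional model: the iterated measure IS `δ(Q′λ)dλ` up to normalisation

In the text all spaces are finite-dimensional (`T_□` is a finite torus) and `dλ`, `dω` are Lebesgue measures, i.e. additive
Haar measures of the respective (sub)spaces.  Here `B`, `W` are finite-dimensional real normed spaces with their Borel
σ-algebras, `N(Q′_j) = LinearMap.ker Qp`, the admissible `ω`'s form a subspace `S ⊂ W` (= `ε(N1)`), and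
`N(Q′) = Submodule.comap Qp S` (`Q′λ = 0 ⟺ Q′_jλ ∈ S`).  The map `(ω, λ′) ↦ λ′ + H′_jω` is a continuous linear
bijection `S × N(Q′_j) ≃ N(Q′)` (`decompEquiv`; §1 in subtype form), so it carries the product of Haar measures to a Haar
measure of `N(Q′)` (`iterated_isAddHaar`), which is a positive multiple of any other (`iterated_eq_smul_addHaar`, Haar
uniqueness) — the remark *"∫dω′↾_Λδ(Q′₁ω′)δ(Q′_jλ′ − ω′) = δ(Q′λ′)"* up to the normalisation constants that cancel in the
quotients (2.105)/(2.106); `iterated_lintegral` / `iterated_integral` identify the pushed-forward measure with the iterated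
integral of §§2–3 (Tonelli / Fubini). -/

section HaarModel

variable {B W : Type*} [NormedAddCommGroup B] [NormedSpace ℝ B] [NormedAddCommGroup W] [NormedSpace ℝ W]

/-- The linear map `(ω, λ′) ↦ λ′ + H′_jω` from `S × N(Q′_j)` INTO `N(Q′) = {λ : Q′_jλ ∈ S}` (well defined because
`Q′_jH′_j = I`, `Q′_jλ′ = 0`). [cite: Balaban1984PropagatorsII, (2.106) p.242] -/
def decompMap (Qp : B →ₗ[ℝ] W) (H : W →ₗ[ℝ] B) (S : Submodule ℝ W) (hH : Qp ∘ₗ H = LinearMap.id) :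
    (S × LinearMap.ker Qp) →ₗ[ℝ] Submodule.comap Qp S :=
  LinearMap.codRestrict (Submodule.comap Qp S)
    (H ∘ₗ S.subtype ∘ₗ LinearMap.fst ℝ S (LinearMap.ker Qp) +
      (LinearMap.ker Qp).subtype ∘ₗ LinearMap.snd ℝ S (LinearMap.ker Qp))
    (by
      intro p
      have h1 : Qp (H p.1) = p.1 := by simpa using LinearMap.congr_fun hH p.1
      have h2 : Qp p.2 = 0 := p.2.2
      simp [Submodule.mem_comap, map_add, h1, h2])

/-- Value of `decompMap`: `(ω, λ′) ↦ λ′ + H′_jω` as an element of `B`. [cite: Balaban1984PropagatorsII, (2.106) p.242] -/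
theorem decompMap_coe (Qp : B →ₗ[ℝ] W) (H : W →ₗ[ℝ] B) (S : Submodule ℝ W) (hH : Qp ∘ₗ H = LinearMap.id)
    (ω : S) (n : LinearMap.ker Qp) :
    ((decompMap Qp H S hH (ω, n) : Submodule.comap Qp S) : B) = (n : B) + H ω := by
  simp [decompMap, add_comm]

/-- **`S × N(Q′_j) → N(Q′)` is a bijection** (= `mem_gaugeSpace_iff` + `decomp_unique` of §1 in subtype form: onto
because `λ = (λ − H′_jQ′_jλ) + H′_j(Q′_jλ)`, one-to-one because `Q′_j` recovers `ω`).
[cite: Balaban1984PropagatorsII, (2.106) p.242] -/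
theorem decompMap_bijective (Qp : B →ₗ[ℝ] W) (H : W →ₗ[ℝ] B) (S : Submodule ℝ W)
    (hH : Qp ∘ₗ H = LinearMap.id) : Function.Bijective (decompMap Qp H S hH) := by
  have h1 : ∀ w, Qp (H w) = w := fun w => by simpa using LinearMap.congr_fun hH w
  constructor
  · rintro ⟨ω, n⟩ ⟨ω', n'⟩ h
    have h' : H ω + (n : B) = H ω' + (n' : B) := by
      simpa [decompMap] using congrArg (fun x : Submodule.comap Qp S => (x : B)) h
    have hω : (ω : W) = ω' := by
      have := congrArg Qp h'
      simpa [map_add, h1, show Qp n = 0 from n.2, show Qp n' = 0 from n'.2] using this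
    have hω' : ω = ω' := Subtype.ext hω
    subst hω'
    have hn : (n : B) = n' := add_left_cancel h'
    exact Prod.ext rfl (Subtype.ext hn)
  · rintro ⟨l, hl⟩
    have hl' : Qp l ∈ S := hl
    refine ⟨(⟨Qp l, hl'⟩, ⟨l - H (Qp l), ?_⟩), ?_⟩
    · show Qp (l - H (Qp l)) = 0
      rw [map_sub, h1, sub_self]
    · apply Subtype.ext
      simp [decompMap]

variable [FiniteDimensional ℝ B] [FiniteDimensional ℝ W]

/-- The decomposition as a continuous linear equivalence `S × N(Q′_j) ≃L N(Q′)` (finite dimension).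
[cite: Balaban1984PropagatorsII, (2.106) p.242] -/
def decompEquiv (Qp : B →ₗ[ℝ] W) (H : W →ₗ[ℝ] B) (S : Submodule ℝ W) (hH : Qp ∘ₗ H = LinearMap.id) :
    (S × LinearMap.ker Qp) ≃L[ℝ] Submodule.comap Qp S :=
  (LinearEquiv.ofBijective (decompMap Qp H S hH) (decompMap_bijective Qp H S hH)).toContinuousLinearEquiv

/-- Value of `decompEquiv`: `(ω, λ′) ↦ λ′ + H′_jω`. [cite: Balaban1984PropagatorsII, (2.106) p.242] -/
theorem decompEquiv_coe (Qp : B →ₗ[ℝ] W) (H : W →ₗ[ℝ] B) (S : Submodule ℝ W) (hH : Qp ∘ₗ H = LinearMap.id)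
    (ω : S) (n : LinearMap.ker Qp) :
    ((decompEquiv Qp H S hH (ω, n) : Submodule.comap Qp S) : B) = (n : B) + H ω := by
  simp [decompEquiv, decompMap, add_comm]

variable [MeasurableSpace B] [BorelSpace B] [MeasurableSpace W] [BorelSpace W]

/-- **The iterated measure `∫dω′↾δ(Q′₁ω′)∫dλ′δ(Q′_jλ′ − ω′)` is a Haar (Lebesgue) measure of `N(Q′)`**: the image of
`dω ⊗ dλ′` (Haar measures of `S` and `N(Q′_j)`) under `(ω, λ′) ↦ λ′ + H′_jω`. [cite: Balaban1984PropagatorsII, (2.106) p.242] -/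
theorem iterated_isAddHaar (Qp : B →ₗ[ℝ] W) (H : W →ₗ[ℝ] B) (S : Submodule ℝ W) (hH : Qp ∘ₗ H = LinearMap.id)
    (ν : Measure S) [ν.IsAddHaarMeasure] (μ : Measure (LinearMap.ker Qp)) [μ.IsAddHaarMeasure] :
    ((ν.prod μ).map (decompEquiv Qp H S hH)).IsAddHaarMeasure :=
  (decompEquiv Qp H S hH).isAddHaarMeasure_map (ν.prod μ)

/-- **«∫dω′↾_Λδ(Q′₁ω′)δ(Q′_jλ′ − ω′) = δ(Q′λ′)» up to normalisation**: for ANY Haar (Lebesgue) measure `τ` of `N(Q′)`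
(a typing of `dλ δ(Q′λ)`) the iterated measure equals `c • τ` with a constant `c > 0` (Haar uniqueness on the
finite-dimensional space `N(Q′)`); the constant cancels between numerator and denominator of (2.105)/(2.106).
[cite: Balaban1984PropagatorsII, (2.105)–(2.106) p.242] -/
theorem iterated_eq_smul_addHaar (Qp : B →ₗ[ℝ] W) (H : W →ₗ[ℝ] B) (S : Submodule ℝ W)
    (hH : Qp ∘ₗ H = LinearMap.id) (ν : Measure S) [ν.IsAddHaarMeasure] (μ : Measure (LinearMap.ker Qp))
    [μ.IsAddHaarMeasure] (τ : Measure (Submodule.comap Qp S)) [τ.IsAddHaarMeasure] :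
    ∃ c : NNReal, c ≠ 0 ∧ (ν.prod μ).map (decompEquiv Qp H S hH) = c • τ := by
  haveI := iterated_isAddHaar Qp H S hH ν μ
  exact ⟨Measure.addHaarScalarFactor ((ν.prod μ).map (decompEquiv Qp H S hH)) τ,
    (Measure.addHaarScalarFactor_pos_of_isAddHaarMeasure _ _).ne', Measure.isAddLeftInvariant_eq_smul _ _⟩

/-- The pushed-forward measure IS the iterated integral of §§2–3 (Tonelli): for measurable `F ≥ 0` on `N(Q′)`,
`∫ F d[(dω ⊗ dλ′)∘(decomp)⁻¹] = ∫dω ∫dλ′ F(λ′ + H′_jω)`. [cite: Balaban1984PropagatorsII, (2.106) p.242] -/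
theorem iterated_lintegral (Qp : B →ₗ[ℝ] W) (H : W →ₗ[ℝ] B) (S : Submodule ℝ W) (hH : Qp ∘ₗ H = LinearMap.id)
    (ν : Measure S) [SFinite ν] (μ : Measure (LinearMap.ker Qp)) [SFinite μ]
    (F : Submodule.comap Qp S → ENNReal) (hF : Measurable F) :
    ∫⁻ l, F l ∂((ν.prod μ).map (decompEquiv Qp H S hH)) =
      ∫⁻ ω, ∫⁻ n, F (decompEquiv Qp H S hH (ω, n)) ∂μ ∂ν := by
  rw [lintegral_map hF (decompEquiv Qp H S hH).continuous.measurable]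
  exact lintegral_prod (fun a => F (decompEquiv Qp H S hH a))
    (hF.comp (decompEquiv Qp H S hH).continuous.measurable).aemeasurable

/-- The same for integrable real `F` (Fubini): `∫ F d[(dω ⊗ dλ′)∘(decomp)⁻¹] = ∫dω ∫dλ′ F(λ′ + H′_jω)`.
[cite: Balaban1984PropagatorsII, (2.106) p.242] -/
theorem iterated_integral (Qp : B →ₗ[ℝ] W) (H : W →ₗ[ℝ] B) (S : Submodule ℝ W) (hH : Qp ∘ₗ H = LinearMap.id)
    (ν : Measure S) [SFinite ν] (μ : Measure (LinearMap.ker Qp)) [SFinite μ]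
    (F : Submodule.comap Qp S → ℝ) (hF : Integrable F ((ν.prod μ).map (decompEquiv Qp H S hH))) :
    ∫ l, F l ∂((ν.prod μ).map (decompEquiv Qp H S hH)) =
      ∫ ω, ∫ n, F (decompEquiv Qp H S hH (ω, n)) ∂μ ∂ν := by
  have he : AEMeasurable (decompEquiv Qp H S hH) (ν.prod μ) :=
    (decompEquiv Qp H S hH).continuous.measurable.aemeasurable
  rw [integral_map he hF.aestronglyMeasurable]
  have hF' : Integrable (fun a => F (decompEquiv Qp H S hH a)) (ν.prod μ) :=
    (integrable_map_measure hF.aestronglyMeasurable he).1 hF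
  exact integral_prod _ hF'

end HaarModel

/-! ## §5  (v1.1, append-only) (2.97) ⇒ (2.105): the gauge transformation `A → A − ∂H′_jω` inside the `ω`-integral

p. 241 [PDF 19], verbatim: *"Let us make a gauge transformation in the integral ∫dA… defined by the function λ₀ = H′_jω,
A → A − ∂λ₀ = A − ∂H′_jω. This transformation does not change the measure dA and in the first exponential only the term
⟨A, J⟩ is changed into ⟨A − ∂H′_jω, J⟩. According to (2.103) the δ-functions δ_{Ax(y)}(Q_jA + ∂₁ω) are changed into
δ_{Ax(y)}(Q_jA). In the first integral ∫dλ′… we get the expression ∂*A^{λ₀} − Δλ′ = ∂*A − Δ(λ′ + λ₀), and we make the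
transformation λ′ → λ′ − λ₀. After the transformation we obtain the same integral with the δ-functions δ(Q′_jλ′) replaced
by δ(Q′_jλ′ − Q′_jλ₀) = δ(Q′_jλ′ − ω). In the last integral in (Z′⁻¹∫dλ…)⁻¹ we make the same transformations, only now in
δ-functions we get Q′λ − Q′λ₀ and Q′_jλ₀ = Q′_jH′_jω = ω = 0 on Λ^c, and Q′_{j+1}λ₀ = Q′₁ω = 0 on Λ′. Thus this integral
is not changed by the transformation. Taking into account all these changes we get [(2.105)]."*

TYPING (continuing §§2–3).  `Av` = the real inner-product space of vector fields `A` with a left-invariant measure `μA`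
(*"does not change the measure dA"*); `grad : B →ₗ Av` = `∂` on scalars, `dstar : Av →ₗ B` = `∂*`, `Δ = ∂*∂`
(`hΔ`); `Qv : Av →ₗ Wv` = `Q_j` on vector fields, `d1 : W →ₗ Wv` = `∂₁`, and (2.103) line 1 (= paper I (1.20))
`Q_j∂λ = ∂₁Q′_jλ` (`h2103`; row B6.Eq2.103, `…B6Eq2103`); the *"first exponential"* without `⟨A,J⟩` is an arbitrary
weight `Φ : Av → ℝ` INVARIANT under `A → A − ∂H′_j(εω)` (`hΦ`: by (2.98) for the gauge-fixing term, row B6.Eq2.98, by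
(2.103)–(2.104) for the `Q`-terms, and `∂∂ = 0` for `‖∂A‖²` — the displayed hypothesis collects these); the product of the
`δ_{Ax(y)}` is an arbitrary function `χ` of the block averages `Q_jA + ∂₁ω`; the last factor `∫dλ δ(Q′λ)…` is an integral
over an abstract group `NQ` (= N(Q′)) with `κ : NQ →ₗ B`, left-invariant `μ'`, containing `λ₀ = H′_j(εω)` (`hκ`, =
*"Q′_jλ₀ = … = 0 on Λ^c, Q′_{j+1}λ₀ = … = 0 on Λ′"*, i.e. `λ₀ ∈ N(Q′)`; §1 `Qp_decomp`).  The normalisations `Z⁻¹`,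
`Z′_j⁻¹`, `Z′⁻¹` are the same on both sides and omitted.  The order of the `ω`- and `A`-integrations is kept as in
(2.97) (`ω` outside); the printed (2.105) writes `∫dA` outside — the exchange is Fubini, recorded separately under an
integrability hypothesis (`eq2105_order`). -/

section GaugeStep

variable {Av B W Wv Nj N1 NQ : Type*} [NormedAddCommGroup Av] [InnerProductSpace ℝ Av] [MeasurableSpace Av]
  [NormedAddCommGroup B] [InnerProductSpace ℝ B] [AddCommGroup W] [Module ℝ W] [AddCommGroup Wv] [Module ℝ Wv]
  [AddCommGroup Nj] [Module ℝ Nj] [MeasurableSpace Nj] [AddCommGroup N1] [Module ℝ N1] [MeasurableSpace N1]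
  [AddCommGroup NQ] [Module ℝ NQ] [MeasurableSpace NQ]

omit [MeasurableSpace N1] in
/-- **(2.97) ⇒ (2.105) at fixed `ω`: the gauge transformation `A → A − ∂H′_jω`.**  For every `ω` the `A`-integral of the
(2.97) integrand `Φ(A)e^{⟨A,J⟩} · χ(Q_jA + ∂₁ω) · ∫dλ′δ(Q′_jλ′)e^{−½‖∂*A−Δλ′‖²} · (∫dλδ(Q′λ)e^{−½‖∂*A−Δλ‖²})⁻¹` equals the
`A`-integral of the (2.105) integrand `χ(Q_jA) Φ(A)e^{⟨A,J⟩} · ∫dλ′δ(Q′_jλ′ − ω)e^{−½‖∂*A−Δλ′‖²} e^{−⟨∂H′_jω,J⟩} ·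
(∫dλδ(Q′λ)e^{−½‖∂*A−Δλ‖²})⁻¹` — translation invariance of `dA` and of `dλ δ(Q′λ)` only; the fibre `δ(Q′_jλ′ − ω)` is
parametrised through `H′_j` as in §2. [cite: Balaban1984PropagatorsII, (2.97) p.240, (2.105) p.242] -/
theorem eq2105_of_2097_fibre [MeasurableAdd Av] [MeasurableAdd NQ] (μA : Measure Av) [μA.IsAddLeftInvariant]
    (μj : Measure Nj) (μ' : Measure NQ) [μ'.IsAddLeftInvariant]
    (grad : B →ₗ[ℝ] Av) (dstar : Av →ₗ[ℝ] B) (lap : B →ₗ[ℝ] B) (hΔ : ∀ b, dstar (grad b) = lap b)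
    (H : W →ₗ[ℝ] B) (Qp : B →ₗ[ℝ] W) (hH : Qp ∘ₗ H = LinearMap.id)
    (Qv : Av →ₗ[ℝ] Wv) (d1 : W →ₗ[ℝ] Wv) (h2103 : ∀ b : B, Qv (grad b) = d1 (Qp b))
    (ι : Nj →ₗ[ℝ] B) (κ : NQ →ₗ[ℝ] B) (ε : N1 →ₗ[ℝ] W) (hκ : ∀ ω : N1, ∃ m₀ : NQ, κ m₀ = H (ε ω))
    (Φ : Av → ℝ) (hΦ : ∀ (a : Av) (ω : N1), Φ (a - grad (H (ε ω))) = Φ a) (χ : Wv → ℝ) (J : Av) (ω : N1) :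
    ∫ a, Φ a * Real.exp ⟪a, J⟫_ℝ * χ (Qv a + d1 (ε ω)) *
        (∫ n, Real.exp (-(1 / 2) * ‖dstar a - lap (ι n)‖ ^ 2) ∂μj) *
        (∫ m, Real.exp (-(1 / 2) * ‖dstar a - lap (κ m)‖ ^ 2) ∂μ')⁻¹ ∂μA =
      ∫ a, χ (Qv a) * (Φ a * Real.exp ⟪a, J⟫_ℝ) *
        (∫ n, Real.exp (-(1 / 2) * ‖dstar a - lap (ι n + H (ε ω))‖ ^ 2) ∂μj) *
        Real.exp (-⟪grad (H (ε ω)), J⟫_ℝ) *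
        (∫ m, Real.exp (-(1 / 2) * ‖dstar a - lap (κ m)‖ ^ 2) ∂μ')⁻¹ ∂μA := by
  set g : Av := grad (H (ε ω)) with hg
  obtain ⟨m₀, hm₀⟩ := hκ ω
  -- the Q′_j-value of λ₀ = H′_j(εω) and the (2.103) identity for the block averages
  have hQH : Qp (H (ε ω)) = ε ω := by simpa using LinearMap.congr_fun hH (ε ω)
  have hQv : Qv g = d1 (ε ω) := by rw [hg, h2103, hQH]
  -- pointwise: the (2.97) integrand at `−g + a` is the (2.105) integrand at `a`
  have hpt : ∀ a : Av,
      Φ (-g + a) * Real.exp ⟪-g + a, J⟫_ℝ * χ (Qv (-g + a) + d1 (ε ω)) *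
          (∫ n, Real.exp (-(1 / 2) * ‖dstar (-g + a) - lap (ι n)‖ ^ 2) ∂μj) *
          (∫ m, Real.exp (-(1 / 2) * ‖dstar (-g + a) - lap (κ m)‖ ^ 2) ∂μ')⁻¹ =
        χ (Qv a) * (Φ a * Real.exp ⟪a, J⟫_ℝ) *
          (∫ n, Real.exp (-(1 / 2) * ‖dstar a - lap (ι n + H (ε ω))‖ ^ 2) ∂μj) *
          Real.exp (-⟪grad (H (ε ω)), J⟫_ℝ) *
          (∫ m, Real.exp (-(1 / 2) * ‖dstar a - lap (κ m)‖ ^ 2) ∂μ')⁻¹ := by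
    intro a
    -- the invariant weight
    have h1 : Φ (-g + a) = Φ a := by rw [neg_add_eq_sub, hg]; exact hΦ a ω
    -- ⟨A − ∂H′_jω, J⟩
    have h2 : Real.exp ⟪-g + a, J⟫_ℝ = Real.exp ⟪a, J⟫_ℝ * Real.exp (-⟪g, J⟫_ℝ) := by
      rw [← Real.exp_add, inner_add_left, inner_neg_left]; ring_nf
    -- the δ_{Ax}-functions: Q_j(A − ∂H′_jω) + ∂₁ω = Q_jA
    have h3 : Qv (-g + a) + d1 (ε ω) = Qv a := by rw [map_add, map_neg, hQv]; abel
    -- ∂*(A − ∂λ₀) = ∂*A − Δλ₀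
    have h4 : dstar (-g + a) = dstar a - lap (H (ε ω)) := by rw [map_add, map_neg, hg, hΔ]; abel
    -- the fibre integral: δ(Q′_jλ′) becomes δ(Q′_jλ′ − ω)
    have h5 : ∀ n, ‖dstar (-g + a) - lap (ι n)‖ = ‖dstar a - lap (ι n + H (ε ω))‖ := by
      intro n; rw [h4, map_add]; congr 1; abel
    -- the last integral is unchanged: λ → λ − λ₀ inside N(Q′)
    have h6 : ∫ m, Real.exp (-(1 / 2) * ‖dstar (-g + a) - lap (κ m)‖ ^ 2) ∂μ' =
        ∫ m, Real.exp (-(1 / 2) * ‖dstar a - lap (κ m)‖ ^ 2) ∂μ' := by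
      have hfun : (fun m => Real.exp (-(1 / 2) * ‖dstar (-g + a) - lap (κ m)‖ ^ 2)) =
          fun m => (fun m' => Real.exp (-(1 / 2) * ‖dstar a - lap (κ m')‖ ^ 2)) (m₀ + m) := by
        funext m
        simp only [h4, map_add, hm₀]
        congr 3
        abel
      rw [hfun]
      exact integral_add_left_eq_self (fun m' => Real.exp (-(1 / 2) * ‖dstar a - lap (κ m')‖ ^ 2)) m₀
    simp_rw [h5]
    rw [h1, h2, h3, h6, hg]
    ring
  calc ∫ a, Φ a * Real.exp ⟪a, J⟫_ℝ * χ (Qv a + d1 (ε ω)) *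
          (∫ n, Real.exp (-(1 / 2) * ‖dstar a - lap (ι n)‖ ^ 2) ∂μj) *
          (∫ m, Real.exp (-(1 / 2) * ‖dstar a - lap (κ m)‖ ^ 2) ∂μ')⁻¹ ∂μA
      = ∫ a, (fun a' => Φ a' * Real.exp ⟪a', J⟫_ℝ * χ (Qv a' + d1 (ε ω)) *
          (∫ n, Real.exp (-(1 / 2) * ‖dstar a' - lap (ι n)‖ ^ 2) ∂μj) *
          (∫ m, Real.exp (-(1 / 2) * ‖dstar a' - lap (κ m)‖ ^ 2) ∂μ')⁻¹) (-g + a) ∂μA :=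
        (integral_add_left_eq_self _ (-g)).symm
    _ = _ := by
        congr 1
        funext a
        exact hpt a

/-- **(2.97) ⇒ (2.105)**, integrated over `ω` (the order of integration of (2.97): `∫dω↾_Λδ(Q′₁ω)` outside).
[cite: Balaban1984PropagatorsII, (2.97) p.240, (2.105) p.242] -/
theorem eq2105_of_2097 [MeasurableAdd Av] [MeasurableAdd NQ] (μA : Measure Av) [μA.IsAddLeftInvariant]
    (μj : Measure Nj) (μ' : Measure NQ) [μ'.IsAddLeftInvariant] (ν : Measure N1)
    (grad : B →ₗ[ℝ] Av) (dstar : Av →ₗ[ℝ] B) (lap : B →ₗ[ℝ] B) (hΔ : ∀ b, dstar (grad b) = lap b)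
    (H : W →ₗ[ℝ] B) (Qp : B →ₗ[ℝ] W) (hH : Qp ∘ₗ H = LinearMap.id)
    (Qv : Av →ₗ[ℝ] Wv) (d1 : W →ₗ[ℝ] Wv) (h2103 : ∀ b : B, Qv (grad b) = d1 (Qp b))
    (ι : Nj →ₗ[ℝ] B) (κ : NQ →ₗ[ℝ] B) (ε : N1 →ₗ[ℝ] W) (hκ : ∀ ω : N1, ∃ m₀ : NQ, κ m₀ = H (ε ω))
    (Φ : Av → ℝ) (hΦ : ∀ (a : Av) (ω : N1), Φ (a - grad (H (ε ω))) = Φ a) (χ : Wv → ℝ) (J : Av) :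
    ∫ ω, ∫ a, Φ a * Real.exp ⟪a, J⟫_ℝ * χ (Qv a + d1 (ε ω)) *
        (∫ n, Real.exp (-(1 / 2) * ‖dstar a - lap (ι n)‖ ^ 2) ∂μj) *
        (∫ m, Real.exp (-(1 / 2) * ‖dstar a - lap (κ m)‖ ^ 2) ∂μ')⁻¹ ∂μA ∂ν =
      ∫ ω, ∫ a, χ (Qv a) * (Φ a * Real.exp ⟪a, J⟫_ℝ) *
        (∫ n, Real.exp (-(1 / 2) * ‖dstar a - lap (ι n + H (ε ω))‖ ^ 2) ∂μj) *
        Real.exp (-⟪grad (H (ε ω)), J⟫_ℝ) *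
        (∫ m, Real.exp (-(1 / 2) * ‖dstar a - lap (κ m)‖ ^ 2) ∂μ')⁻¹ ∂μA ∂ν := by
  congr 1
  funext ω
  exact eq2105_of_2097_fibre μA μj μ' grad dstar lap hΔ H Qp hH Qv d1 h2103 ι κ ε hκ Φ hΦ χ J ω

end GaugeStep

section Order

variable {N1 Av : Type*} [MeasurableSpace N1] [MeasurableSpace Av]

/-- The printed order of (2.105) (`∫dA` outside, `∫dω↾_Λδ(Q′₁ω)` inside) is the Fubini exchange of the right-hand side
of `eq2105_of_2097`, valid for s-finite measures and an integrable integrand. [cite: Balaban1984PropagatorsII, (2.105) p.242] -/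
theorem eq2105_order (ν : Measure N1) [SFinite ν] (μA : Measure Av) [SFinite μA] (F : N1 → Av → ℝ)
    (hF : Integrable (Function.uncurry F) (ν.prod μA)) :
    ∫ ω, ∫ a, F ω a ∂μA ∂ν = ∫ a, ∫ ω, F ω a ∂ν ∂μA :=
  integral_integral_swap hF

end Order

end Literature.MathematicalPhysics.QuantumFieldTheory.Balaban1983to89.B6Eq2106
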